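import Summits.AtomisticToContinuum.BoseEinsteinCondensation.Theses.BECRewardDescent
import Summits.AtomisticToContinuum.BoseEinsteinCondensation.Theorems.BECRewardDescentRewardChordBoundNoKinkOfSimpleHelpers
import HarnessLib

/-!
# `RewardChordBound` (stmt-AtomisticToContinuum-12876), line `registered`, stub 5 `noKinkOfSimple`:
# a strict Ky-Fan gap of the rewarded functional rules out a kink of the reward curve

Route `BECRewardDescent`, finite volume `(N, L)`, reward `s > 0`. With the rewarded functional
`F_t(Ψ) = ⟨Ψ,HΨ⟩ + t·(N − ⟨Ψ,n̂₀Ψ⟩)` on periodic `C¹` trial states and the reward curve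
`R(t) = inf_Ψ F_t(Ψ)` (an infimum of functions affine in `t` with slopes `dep(Ψ) = N − n₀(Ψ) ∈ [0,N]`,
hence concave), the theorem `stub_noKinkOfSimple` says: if `R(s) < ∞` and `F_s` has a STRICT Ky-Fan
gap over all `L²(cell)`-orthogonal pairs (simplicity of the rewarded ground state, in vector-free
form), then for every `ε > 0` there is `h₀ > 0` with `2R(s) ≤ R(s+h) + R(s−h) + εh` for all
`0 < h < h₀` — the one-sided derivatives of `R` at `s` agree (no level crossing at `s`).

Proof (purely variational, all measurable `v`, hard cores included):
* `two_mul_iInf_le_of_oscillation` (abstract, `ℝ≥0∞` order theory): for `R(t) = inf_i E_i + t·D_i`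
  with `D_i ≤ M < ∞`, if the slopes `D` of the `δ`-near-minimisers of `F_s` oscillate by at most `ε`
  for small `δ`, then `2R(s) ≤ R(s+h) + R(s−h) + εh` for small `h` (test `R(s±h)` on all states:
  near-minimisers move affinely with almost the same slope, the others pay at least `δ ≥ hM`);
* the oscillation hypothesis for `D = dep`: by the clustering theorem for the rewarded functional
  (`stub_noKinkOfSimpleRewardClustering`, parallelogram law — helpers file) two near-minimisers are
  `L²(cell)`-close up to a phase, and `n₀` is phase invariant and `L²`-Lipschitz on the unit ball
  (`Literature…PeriodicTrialState.condensateOccupation_le_add_of_phase_sq_dist_le`).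

References: Ky Fan (1949) Thm. 1; [ReedSimonIV1978] Thm. XIII.1–2, §XIII.12; [Griffiths1966];
[LSSY2005] App. A (A.11), (A.13).
-/

noncomputable section

open MeasureTheory Filter
open scoped ENNReal NNReal ComplexConjugate

namespace Summit.AtomisticToContinuum.BoseEinsteinCondensation.Cruxes.RewardChordBound.Birth

namespace NoKink

open Literature.MathematicalPhysics.QuantumManyBody.BoseGas

variable {N : ℕ} {L : ℝ} {v : ℝ → ℝ≥0∞}

/-! ### No kink from small oscillation of the slopes of near-minimisers -/

/-- Truncated-subtraction bookkeeping: `b ≤ a + e ⇒ c - a ≤ (c - b) + e` in `ℝ≥0∞`. [folklore] -/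
theorem tsub_le_tsub_add_of_le_add {a b c e : ℝ≥0∞} (h : b ≤ a + e) : c - a ≤ (c - b) + e := by
  rw [tsub_le_iff_right]
  calc c ≤ c - b + b := le_tsub_add
    _ ≤ c - b + (a + e) := add_le_add le_rfl h
    _ = c - b + e + a := by rw [add_comm a e, add_assoc]

/-- `x ≤ f i + a` for all `i` gives `x ≤ inf f + a` in `ℝ≥0∞`. [folklore] -/
theorem le_iInf_add_of_forall_le {ι : Sort*} {f : ι → ℝ≥0∞} {a x : ℝ≥0∞} (h : ∀ i, x ≤ f i + a) :
    x ≤ iInf f + a := by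
  rw [ENNReal.iInf_add]
  exact le_iInf h

/-- **No kink from small oscillation of the slopes** (abstract walk step, `ℝ≥0∞`). Let
`R(t) = inf_i (E_i + t·D_i)` with `D_i ≤ M < ∞`, `s > 0`, `R(s) < ∞`. If for every `ε > 0` there is
`δ > 0` such that any two `δ`-near-minimisers `i, j` of `E + s·D` have `D_i ≤ D_j + ε`, then for
every `ε > 0` there is `h₀ > 0` with `2R(s) ≤ R(s+h) + R(s−h) + εh` for `0 < h < h₀`. Proof: with a
fixed near-minimiser `j`, every `i` satisfies `R(s) + hD_j ≤ (E_i + (s+h)D_i) + εh/2` and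
`R(s) ≤ (E_i + (s−h)D_i) + hD_j + εh/2` (near-minimisers by the affine identities
`E + (s±h)D = (E + sD) ± hD` and the oscillation bound, the others because they pay `δ ≥ hM ≥ hD`).
(Griffiths' convexity bookkeeping.) [folklore] -/
theorem two_mul_iInf_le_of_oscillation {ι : Type*} (E D : ι → ℝ≥0∞) {M : ℝ≥0∞} (hM : M ≠ ⊤)
    (hD : ∀ i, D i ≤ M) {s : ℝ} (hs : 0 < s) (hR : (⨅ i, E i + ENNReal.ofReal s * D i) ≠ ⊤)
    (hosc : ∀ ε : ℝ, 0 < ε → ∃ δ : ℝ≥0∞, 0 < δ ∧ ∀ i j : ι,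
      E i + ENNReal.ofReal s * D i ≤ (⨅ i, E i + ENNReal.ofReal s * D i) + δ →
      E j + ENNReal.ofReal s * D j ≤ (⨅ i, E i + ENNReal.ofReal s * D i) + δ →
      D i ≤ D j + ENNReal.ofReal ε)
    {ε : ℝ} (hε : 0 < ε) :
    ∃ h₀ : ℝ, 0 < h₀ ∧ ∀ h : ℝ, 0 < h → h < h₀ →
      2 * (⨅ i, E i + ENNReal.ofReal s * D i) ≤
        (⨅ i, E i + ENNReal.ofReal (s + h) * D i) + (⨅ i, E i + ENNReal.ofReal (s - h) * D i) +
          ENNReal.ofReal (ε * h) := by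
  set R : ℝ≥0∞ := ⨅ i, E i + ENNReal.ofReal s * D i with hRdef
  have hRle : ∀ i, R ≤ E i + ENNReal.ofReal s * D i := fun i => iInf_le _ i
  obtain ⟨δ, hδ, hoscδ⟩ := hosc (ε / 2) (half_pos hε)
  -- a finite positive slack `δ₁ ≤ δ`
  set δ₁ : ℝ≥0∞ := min δ 1 with hδ₁
  have hδ₁pos : 0 < δ₁ := lt_min hδ one_pos
  have hδ₁top : δ₁ ≠ ⊤ := ne_top_of_le_ne_top ENNReal.one_ne_top (min_le_right _ _)
  have hδ₁δ : δ₁ ≤ δ := min_le_left _ _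
  have hδ₁r : 0 < δ₁.toReal := ENNReal.toReal_pos hδ₁pos.ne' hδ₁top
  refine ⟨min s (δ₁.toReal / (M.toReal + 1)), lt_min hs (by positivity), fun h hh hlt => ?_⟩
  have hhs : h < s := lt_of_lt_of_le hlt (min_le_left _ _)
  have hhδ : h < δ₁.toReal / (M.toReal + 1) := lt_of_lt_of_le hlt (min_le_right _ _)
  -- `h·M ≤ δ₁`
  have hhM : ENNReal.ofReal h * M ≤ δ₁ := by
    rw [← ENNReal.ofReal_toReal hM, ← ENNReal.ofReal_mul hh.le, ← ENNReal.ofReal_toReal hδ₁top]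
    refine ENNReal.ofReal_le_ofReal ?_
    have hM0 : 0 ≤ M.toReal := ENNReal.toReal_nonneg
    rw [lt_div_iff₀ (by positivity)] at hhδ
    nlinarith
  -- the affine identities `F_{s+h} = F_s + h·D`, `F_s = F_{s-h} + h·D`
  have hplus : ∀ i, E i + ENNReal.ofReal (s + h) * D i =
      (E i + ENNReal.ofReal s * D i) + ENNReal.ofReal h * D i := by
    intro i; rw [ENNReal.ofReal_add hs.le hh.le, add_mul, add_assoc]
  have hminus : ∀ i, E i + ENNReal.ofReal s * D i =
      (E i + ENNReal.ofReal (s - h) * D i) + ENNReal.ofReal h * D i := by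
    intro i
    have e : ENNReal.ofReal s = ENNReal.ofReal (s - h) + ENNReal.ofReal h := by
      rw [← ENNReal.ofReal_add (by linarith) hh.le]; congr 1; ring
    rw [e, add_mul, add_assoc]
  have hεh : ENNReal.ofReal h * ENNReal.ofReal (ε / 2) = ENNReal.ofReal (ε / 2 * h) := by
    rw [← ENNReal.ofReal_mul hh.le]; congr 1; ring
  -- a `δ₁`-near-minimiser `j`
  obtain ⟨j, hj⟩ := iInf_lt_iff.1 (ENNReal.lt_add_right hR hδ₁pos.ne')
  have hjM : E j + ENNReal.ofReal s * D j ≤ R + δ := hj.le.trans (add_le_add le_rfl hδ₁δ)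
  -- (A) `R + h·D_j ≤ R(s+h) + εh/2`
  have hA : R + ENNReal.ofReal h * D j ≤
      (⨅ i, E i + ENNReal.ofReal (s + h) * D i) + ENNReal.ofReal (ε / 2 * h) := by
    refine le_iInf_add_of_forall_le fun i => ?_
    rcases le_or_gt (E i + ENNReal.ofReal s * D i) (R + δ₁) with hi | hi
    · have hosc1 : D j ≤ D i + ENNReal.ofReal (ε / 2) :=
        hoscδ j i hjM (hi.trans (add_le_add le_rfl hδ₁δ))
      calc R + ENNReal.ofReal h * D j ≤
            (E i + ENNReal.ofReal s * D i) + ENNReal.ofReal h * (D i + ENNReal.ofReal (ε / 2)) :=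
            add_le_add (hRle i) (mul_le_mul' le_rfl hosc1)
        _ = (E i + ENNReal.ofReal (s + h) * D i) + ENNReal.ofReal (ε / 2 * h) := by
            rw [hplus i, mul_add, hεh]; ring
    · calc R + ENNReal.ofReal h * D j ≤ R + ENNReal.ofReal h * M :=
            add_le_add le_rfl (mul_le_mul' le_rfl (hD j))
        _ ≤ R + δ₁ := add_le_add le_rfl hhM
        _ ≤ E i + ENNReal.ofReal s * D i := hi.le
        _ ≤ E i + ENNReal.ofReal (s + h) * D i := by rw [hplus i]; exact le_self_add
        _ ≤ _ := le_self_add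
  -- (B) `R ≤ R(s-h) + h·D_j + εh/2`
  have hB : R ≤ (⨅ i, E i + ENNReal.ofReal (s - h) * D i) + ENNReal.ofReal h * D j +
      ENNReal.ofReal (ε / 2 * h) := by
    rw [add_assoc]
    refine le_iInf_add_of_forall_le fun i => ?_
    rcases le_or_gt (E i + ENNReal.ofReal s * D i) (R + δ₁) with hi | hi
    · have hosc2 : D i ≤ D j + ENNReal.ofReal (ε / 2) :=
        hoscδ i j (hi.trans (add_le_add le_rfl hδ₁δ)) hjM
      calc R ≤ E i + ENNReal.ofReal s * D i := hRle i
        _ = (E i + ENNReal.ofReal (s - h) * D i) + ENNReal.ofReal h * D i := hminus i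
        _ ≤ (E i + ENNReal.ofReal (s - h) * D i) +
              ENNReal.ofReal h * (D j + ENNReal.ofReal (ε / 2)) :=
            add_le_add le_rfl (mul_le_mul' le_rfl hosc2)
        _ = _ := by rw [mul_add, hεh]
    · have hlt' : R + δ₁ < (E i + ENNReal.ofReal (s - h) * D i) + δ₁ :=
        calc R + δ₁ < E i + ENNReal.ofReal s * D i := hi
          _ = (E i + ENNReal.ofReal (s - h) * D i) + ENNReal.ofReal h * D i := hminus i
          _ ≤ (E i + ENNReal.ofReal (s - h) * D i) + ENNReal.ofReal h * M :=
              add_le_add le_rfl (mul_le_mul' le_rfl (hD i))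
          _ ≤ (E i + ENNReal.ofReal (s - h) * D i) + δ₁ := add_le_add le_rfl hhM
      exact (lt_of_add_lt_add_right hlt').le.trans le_self_add
  -- assemble
  calc 2 * R = R + R := two_mul R
    _ ≤ R + ((⨅ i, E i + ENNReal.ofReal (s - h) * D i) + ENNReal.ofReal h * D j +
          ENNReal.ofReal (ε / 2 * h)) := add_le_add le_rfl hB
    _ = (R + ENNReal.ofReal h * D j) + (⨅ i, E i + ENNReal.ofReal (s - h) * D i) +
          ENNReal.ofReal (ε / 2 * h) := by ring
    _ ≤ ((⨅ i, E i + ENNReal.ofReal (s + h) * D i) + ENNReal.ofReal (ε / 2 * h)) +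
          (⨅ i, E i + ENNReal.ofReal (s - h) * D i) + ENNReal.ofReal (ε / 2 * h) :=
        add_le_add (add_le_add hA le_rfl) le_rfl
    _ = (⨅ i, E i + ENNReal.ofReal (s + h) * D i) + (⨅ i, E i + ENNReal.ofReal (s - h) * D i) +
          (ENNReal.ofReal (ε / 2 * h) + ENNReal.ofReal (ε / 2 * h)) := by ring
    _ = _ := by
        rw [← ENNReal.ofReal_add (by positivity) (by positivity),
          show ε / 2 * h + ε / 2 * h = ε * h by ring]

/-- **Small oscillation of the depletion across near-minimisers of the rewarded functional** from a
strict Ky-Fan gap (`N ≥ 1`): clustering up to a phase (registered helper stub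
`stub_noKinkOfSimpleRewardClustering` of the helpers file),
phase invariance and `L²`-Lipschitz continuity of `n₀` on the unit ball. [folklore] -/
theorem depletion_oscillation_of_rewardGap {n : ℕ} (hv : Measurable v) (s : ℝ) {γ : ℝ} (hγ : 0 < γ)
    (hE : (⨅ Ψ : PeriodicTrialState (n + 1) L, (periodicEnergy v Ψ +
      ENNReal.ofReal s * (((n + 1 : ℕ) : ℝ≥0∞) - condensateOccupation (n + 1) L Ψ.ψ))) ≠ ⊤)
    (hgap : ∀ Φ₁ Φ₂ : PeriodicTrialState (n + 1) L,
      (∫ X in cellN (n + 1) L, conj (Φ₁.ψ X) * Φ₂.ψ X) = 0 →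
        2 * (⨅ Ψ : PeriodicTrialState (n + 1) L, (periodicEnergy v Ψ +
            ENNReal.ofReal s * (((n + 1 : ℕ) : ℝ≥0∞) - condensateOccupation (n + 1) L Ψ.ψ))) +
            ENNReal.ofReal γ ≤
          (periodicEnergy v Φ₁ +
            ENNReal.ofReal s * (((n + 1 : ℕ) : ℝ≥0∞) - condensateOccupation (n + 1) L Φ₁.ψ)) +
          (periodicEnergy v Φ₂ +
            ENNReal.ofReal s * (((n + 1 : ℕ) : ℝ≥0∞) - condensateOccupation (n + 1) L Φ₂.ψ)))
    {ε : ℝ} (hε : 0 < ε) :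
    ∃ δ : ℝ≥0∞, 0 < δ ∧ ∀ Φ Φ' : PeriodicTrialState (n + 1) L,
      periodicEnergy v Φ +
          ENNReal.ofReal s * (((n + 1 : ℕ) : ℝ≥0∞) - condensateOccupation (n + 1) L Φ.ψ) ≤
        (⨅ Ψ : PeriodicTrialState (n + 1) L, (periodicEnergy v Ψ +
          ENNReal.ofReal s * (((n + 1 : ℕ) : ℝ≥0∞) - condensateOccupation (n + 1) L Ψ.ψ))) + δ →
      periodicEnergy v Φ' +
          ENNReal.ofReal s * (((n + 1 : ℕ) : ℝ≥0∞) - condensateOccupation (n + 1) L Φ'.ψ) ≤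
        (⨅ Ψ : PeriodicTrialState (n + 1) L, (periodicEnergy v Ψ +
          ENNReal.ofReal s * (((n + 1 : ℕ) : ℝ≥0∞) - condensateOccupation (n + 1) L Ψ.ψ))) + δ →
      ((n + 1 : ℕ) : ℝ≥0∞) - condensateOccupation (n + 1) L Φ.ψ ≤
        (((n + 1 : ℕ) : ℝ≥0∞) - condensateOccupation (n + 1) L Φ'.ψ) + ENNReal.ofReal ε := by
  -- `L > 0` from the existence of a trial state
  have hne : Nonempty (PeriodicTrialState (n + 1) L) := by
    by_contra hne
    rw [not_nonempty_iff] at hne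
    exact hE (iInf_of_empty _)
  obtain ⟨Ψ₀⟩ := hne
  have hL : 0 < L := by
    by_contra hL
    have h1 := Ψ₀.norm_eq
    have hempty : cellN (n + 1) L = ∅ := by
      refine Set.eq_empty_iff_forall_notMem.2 fun X hX => ?_
      have h := (hX 0) 0
      rw [Set.mem_Ico] at h
      linarith [h.1, h.2, not_lt.mp hL]
    rw [hempty, Measure.restrict_empty, lintegral_zero_measure] at h1
    exact zero_ne_one h1
  -- clustering at precision `η = (ε/(2N+1))²`
  have hK : (0 : ℝ) < 2 * ((n + 1 : ℕ) : ℝ) + 1 := by positivity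
  set η : ℝ := (ε / (2 * ((n + 1 : ℕ) : ℝ) + 1)) ^ 2 with hη
  have hη0 : 0 < η := by positivity
  have hsq : 2 * ((n + 1 : ℕ) : ℝ) * Real.sqrt η ≤ ε := by
    rw [hη, Real.sqrt_sq (by positivity),
      show 2 * ((n + 1 : ℕ) : ℝ) * (ε / (2 * ((n + 1 : ℕ) : ℝ) + 1)) =
        ε * (2 * ((n + 1 : ℕ) : ℝ) / (2 * ((n + 1 : ℕ) : ℝ) + 1)) by ring]
    refine mul_le_of_le_one_right hε.le ?_
    rw [div_le_one hK]
    linarith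
  refine ⟨ENNReal.ofReal (γ * η / 16), ENNReal.ofReal_pos.2 (by positivity), fun Φ Φ' hΦ hΦ' => ?_⟩
  obtain ⟨θ, hθ⟩ :=
    stub_noKinkOfSimpleRewardClustering v (n + 1) L s γ η hv hL hγ hη0 hE hgap Φ Φ' hΦ hΦ'
  have hlip := PeriodicTrialState.condensateOccupation_le_add_of_phase_sq_dist_le hL Φ Φ' hθ
  exact tsub_le_tsub_add_of_le_add (hlip.trans (add_le_add le_rfl (ENNReal.ofReal_le_ofReal hsq)))

end NoKink

/-- **stub 5 — `NoKinkOfSimple`** (finite volume, purely variational; all measurable `v`, hard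
cores included). At fixed `(N, L)` and reward `s > 0` with `R(s) < ∞`: IF the rewarded functional
`F_s(Ψ) = ⟨Ψ,HΨ⟩ + s·(N − ⟨Ψ,n̂₀Ψ⟩)` has a strict Ky-Fan gap over all `L²(cell)`-orthogonal pairs of
periodic trial states (`2R(s) + g ≤ F_s(Φ₁) + F_s(Φ₂)`, `g > 0` — simplicity of the rewarded ground
state in vector-free form), THEN the concave reward curve `R(t) = inf_Ψ F_t(Ψ)` has no kink at `s`:
`∀ ε > 0 ∃ h₀ > 0 ∀ h ∈ (0,h₀), 2R(s) ≤ R(s+h) + R(s−h) + εh`. Proof: clustering of near-minimisers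
of `F_s` up to a phase from the Ky-Fan gap (parallelogram law, `stub_noKinkOfSimpleRewardClustering`),
`L²`-Lipschitz continuity of the bounded quadratic form `n̂₀` (so the slopes `dep = N − n₀` of the
near-minimisers oscillate little, `NoKink.depletion_oscillation_of_rewardGap`), and the affine
identities `F_{s±h} = F_s ± h·dep` (`NoKink.two_mul_iInf_le_of_oscillation`); `N = 0` is trivial
(`dep ≡ 0`). References: Ky Fan (1949) Thm. 1; Reed–Simon IV Thm. XIII.1–2; Griffiths (1966),
Appendix. [folklore] -/
theorem stub_noKinkOfSimple :
    ∀ v : ℝ → ENNReal, Literature.MathematicalPhysics.QuantumManyBody.BoseGas.IsRepulsiveFiniteRange v → ∀ (N : ℕ) (L s : ℝ), 0 < s → (⨅ Ψ : Literature.MathematicalPhysics.QuantumManyBody.BoseGas.PeriodicTrialState N L, (Literature.MathematicalPhysics.QuantumManyBody.BoseGas.periodicEnergy v Ψ + ENNReal.ofReal s * ((N : ENNReal) - Literature.MathematicalPhysics.QuantumManyBody.BoseGas.condensateOccupation N L Ψ.ψ))) ≠ ⊤ → (∃ g : ℝ, 0 < g ∧ (∀ Φ₁ Φ₂ : Literature.MathematicalPhysics.QuantumManyBody.BoseGas.PeriodicTrialState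 N L, (∫ X in Literature.MathematicalPhysics.QuantumManyBody.BoseGas.cellN N L, starRingEnd ℂ (Φ₁.ψ X) * Φ₂.ψ X) = 0 → 2 * (⨅ Ψ : Literature.MathematicalPhysics.QuantumManyBody.BoseGas.PeriodicTrialState N L, (Literature.MathematicalPhysics.QuantumManyBody.BoseGas.periodicEnergy v Ψ + ENNReal.ofReal s * ((N : ENNReal) - Literature.MathematicalPhysics.QuantumManyBody.BoseGas.condensateOccupation N L Ψ.ψ))) + ENNReal.ofReal g ≤ (Literature.MathematicalPhysics.QuantumManyBody.BoseGas.periodicEnergy v Φ₁ + ENNReal.ofReal s * ((N : ENNReal) - Literature.MathematicalPhysics.QuantumManyBody.BoseGas.condensateOccupation N L Φ₁.ψ)) + (Literature.MathematicalPhysics.QuantumManyBody.BoseGas.periodicEnergy v Φ₂ + ENNReal.ofReal s * ((N : ENNReal) - Literature.MathematicalPhysics.QuantumManyBody.BoseGas.condensateOccupation N L Φ₂.ψ)))) → ∀ ε : ℝ, 0 < ε → ∃ h₀ : ℝ, 0 < h₀ ∧ ∀ h : ℝ, 0 < h → h < h₀ → 2 * (⨅ Ψ : Literature.MathematicalPhysics.QuantumManyBody.BoseGas.PeriodicTrialState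 N L, (Literature.MathematicalPhysics.QuantumManyBody.BoseGas.periodicEnergy v Ψ + ENNReal.ofReal s * ((N : ENNReal) - Literature.MathematicalPhysics.QuantumManyBody.BoseGas.condensateOccupation N L Ψ.ψ))) ≤ (⨅ Ψ : Literature.MathematicalPhysics.QuantumManyBody.BoseGas.PeriodicTrialState N L, (Literature.MathematicalPhysics.QuantumManyBody.BoseGas.periodicEnergy v Ψ + ENNReal.ofReal (s + h) * ((N : ENNReal) - Literature.MathematicalPhysics.QuantumManyBody.BoseGas.condensateOccupation N L Ψ.ψ))) + (⨅ Ψ : Literature.MathematicalPhysics.QuantumManyBody.BoseGas.PeriodicTrialState N L, (Literature.MathematicalPhysics.QuantumManyBody.BoseGas.periodicEnergy v Ψ + ENNReal.ofReal (s - h) * ((N : ENNReal) - Literature.MathematicalPhysics.QuantumManyBody.BoseGas.condensateOccupation N L Ψ.ψ))) + ENNReal.ofReal (ε * h) := by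
  intro v hv N L s hs hR hgap ε hε
  obtain ⟨g, hg, hgap⟩ := hgap
  refine NoKink.two_mul_iInf_le_of_oscillation
    (fun Ψ => Literature.MathematicalPhysics.QuantumManyBody.BoseGas.periodicEnergy v Ψ)
    (fun Ψ => (N : ℝ≥0∞) -
      Literature.MathematicalPhysics.QuantumManyBody.BoseGas.condensateOccupation N L Ψ.ψ)
    (ENNReal.natCast_ne_top N) (fun Ψ => tsub_le_self) hs hR ?_ hε
  intro ε' hε'
  cases N with
  | zero => exact ⟨1, one_pos, fun Φ Φ' _ _ => by simp⟩
  | succ n => exact NoKink.depletion_oscillation_of_rewardGap hv.1 s hg hR hgap hε'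

end Summit.AtomisticToContinuum.BoseEinsteinCondensation.Cruxes.RewardChordBound.Birth

end
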